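import Summits.BirchSwinnertonDyer.Rank1Residual.AdditivePotMult.RankOneIndexCertificate
import Summits.BirchSwinnertonDyer.Rank1Residual.X11b.MultiplicativeSurjectivityTwist
import Summits.BirchSwinnertonDyer.Rank1Residual.X2.TwistTamagawa
import HarnessLib

/-!
# Rank ONE at an additive (indeed ANY bad) ODD prime, `p = 3` included: the EXACT Heegner-index
# certificate closes the pair AND its rank-zero Heegner twist (cell `b2b-bsdres`, seat additive-p1, gen 10)

HONEST FRAMING (cell `b2b-bsdres`, run/shared/lean/b2b/bsd-rank1-residual/, verbatim in every
file): the goal of the cell is to DELETE the COMBINATION-SHAPED residual classes of the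
Birch–Swinnerton-Dyer formula for ALL analytic-rank `≤ 1` elliptic curves over `ℚ` — "full BSD
formula for every rank `≤ 1` curve in class `C`" assembled STRICTLY from published theorems — so
that the rank-`≤ 1` remainder becomes exactly the CONSTRUCTION-SHAPED classes, which are TYPED
(missing-input `Prop`s), NOT attempted. This is not "finishing BSD". Sub-cell additive-p1 is a
RESEARCH ROUTE on the construction-shaped classes X3♯(M) / X4(M) (additive, potentially
multiplicative `p`); no claim beyond the stated sub-classes; X3/X4 labels are UNCHANGED by this file;
NOTHING is booked here (a per-pair closure is the referee's ruling on the lane's certificates).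

THEOREMS ONLY (no definition, no named fact). PER PAIR, not a class theorem.

Gen 5's `RankOneIndexCertificate.lean` (p207447) turns the FINITE certificate
`p ∤ [E(K):ℤP]` ∧ `ord_p (L(E^{d_K},1)/Ω_{E^{d_K}}) = 0` ∧ `p ∤ ∏_ℓ c_ℓ(E)` ∧ `p ∤ c(D)` at a rank-one
pair with `ρ̄_{E,p}` onto into `ord_p #Ш(E)_an = 0` ∧ `BSD(E,p)` ∧ `BSD(E^{d_K},p)` — its §1
(`bsdp_of_rankOne_of_indexCertificate`) at EVERY odd `p`, but its conductor-level packaging (§2–§3,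
`…_of_dvd`, `ClassX4.…`, `ClassX4M.…_of_ram`) at `p ≥ 5` only, because the twist's closure used
multr1-p2's Tamagawa transport `ord_p ∏c(E^{d_K}) = ord_p ∏c(E)` via Kodaira–Néron `c ≤ 4 < p`. At
`p = 3` — where 87 of the 98 rank-one X4(M) census pairs (`N < 2·10⁴`) live — eisenstein-p2's
`X2.padicValNat_tamagawaProduct_twist_of_heegner_of_odd` gives the transport for a Heegner field with
ODD discriminant (type `I₀*` at `ℓ ∣ d_K`, `c_ℓ ∈ {1,2,4}`). This file is the `p`-odd packaging:

* `bsdp_of_rankOne_of_indexCertificate_of_dvd` — the PAIR alone, ANY odd `p ∣ N_E`, any Heegner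
  field with `d_K < −4` (no parity condition on `d_K`): `BSDp W p`;
* `bsdp_and_bsdp_twist_of_indexCertificate_of_odd` — pair AND twist, any odd `p ∣ N_E`, `d_K` odd,
  `d_K < −4`: `BSDp W p ∧ BSDp Wd p`;
* `ClassX4M.bsdp_rankOne_of_indexCertificate_of_surj` / `…_of_not_dvd_padicValRat_j` — this
  sub-cell's reading at every odd `p` (surj(p) as a hypothesis, or decided by `p ∤ ord_p j(E)` —
  multr1-p2's `ClassX4M.surj_of_not_dvd_padicValRat_j`, valid at `p = 3`).

Target population at `p = 3` (hyp_bits.tsv, `N < 2·10⁴`): 87 rank-one X4(M) pairs, 85 with surj(3)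
(73 by `3 ∤ ord₃ j`), 52 of them with `3 ∤ ∏c_ℓ(E)`, all with a Manin-unit optimal curve; the
certificate rows (two engines) are lane / seat business (this seat's census-g10), NOT booked here.

References: [McCallumLMS1991] §1; [GrossLMS1991] Thm. 1.3 / Prop. 2.1; [Kolyvagin1990] Thm. A;
[JetchevSkinnerWan2017] §7.4; [GrossZagier1986], [CaiShuTian2014]; [Miller2011LMS] Def. 1.1;
[SilvermanATAEC1994] IV.9.4 Table 4.1 (type `I₀*`).
-/

noncomputable section

open scoped Classical NumberField

open WeierstrassCurve NumberField Literature.NumberTheory.EllipticCurves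
  Literature.NumberTheory.EllipticCurves.ModularForms
  Literature.NumberTheory.EllipticCurves.Rank1Residual
  Literature.NumberTheory.EllipticCurves.Rank1Residual.Typed
  Literature.NumberTheory.EllipticCurves.KrizLi2019
  Literature.NumberTheory.QuadraticFields
  Literature.NumberTheory.Automorphic
  IsDedekindDomain

namespace Summit.BirchSwinnertonDyer.Rank1Residual.AdditivePotMult

/-! ### §1 The pair alone, any odd `p ∣ N_E`, any Heegner field with `d_K < -4` -/

/-- **Rank one, ANY odd `p ∣ N_E` (additive included), `ρ̄_{E,p}` onto: `BSD(E,p)` from the exact index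
certificate** — gen 5's `bsdp_of_rankOne_of_indexCertificate` at the conductor level with its two
side values DISCHARGED: `ord_p u(Cd) = 0` for the minimal twist model (`p ∣ N_E` splits in `K`, so
`d_K ∈ ℚ_p^{×2}`: `padicValRat_u_eq_zero_of_twist_minimal_of_dvd`) and `p ∤ w_K = 2` (`d_K < −4`).
CERTIFICATE: `q_d = L(E^{d_K},1)/Ω(Wd) ≠ 0` with `ord_p q_d = 0`, `p ∤ [E(K):ℤP]`, `p ∤ ∏_ℓ c_ℓ(E)`,
`p ∤ c(Dt)`. No parity condition on `d_K`. Per pair; nothing booked.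
[cite: McCallumLMS1991, §1 Theorem (Kolyvagin), p. 296] [cite: JetchevSkinnerWan2017, §7.4.1 (eq:gz for K′)]
[cite: Miller2011LMS, Def. 1.1] -/
theorem bsdp_of_rankOne_of_indexCertificate_of_dvd
    (W : WeierstrassCurve ℚ) [W.IsElliptic] [W.IsGloballyMinimal] (p : ℕ) [Fact p.Prime]
    [NeZero (W.conductorNorm ℤ)] (K : Type) [Field K] [NumberField K]
    (Dt : ModularParametrizationData W (W.conductorNorm ℤ))
    (H : HeegnerDatum (W.conductorNorm ℤ) (NumberField.discr K)) (ι : K →+* ℂ)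
    (P : (W.baseChange K).toAffine.Point)
    -- the published inputs (named facts of the tree)
    (hGZ : gross_zagier (W.conductorNorm ℤ) W K) (hKo : kolyvagin (W.conductorNorm ℤ) W K)
    (hB : Kolyvagin1990_padicValNat_card_sha_le (W.conductorNorm ℤ) W K)
    (hGZK : rank_eq_analyticRank_of_analyticRank_le_one) (hmod : hasEntireLFunction_rat)
    -- the pair and the Heegner data
    (hp2 : p ≠ 2) (hpN : p ∣ W.conductorNorm ℤ) (hr : W.analyticRank = 1) (hsurj : Surj W p)
    (hK : IsImaginaryQuadratic K) (hHN : SatisfiesHeegnerHypothesis (W.conductorNorm ℤ) K)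
    (hdK : NumberField.discr K < -4)
    (hP : WeierstrassCurve.Affine.Point.map ι.toRatAlgHom P = heegnerPointComplex Dt H)
    (hc : ¬ (p : ℤ) ∣ Dt.c)
    (Wd : WeierstrassCurve ℚ) [Wd.IsElliptic] [Wd.IsGloballyMinimal] (Cd : VariableChange ℚ)
    (hWd : Cd • W.quadraticTwist (NumberField.discr K : ℚ) = Wd)
    -- the certificate
    (qd : ℚ) (hqd : Wd.entireLFunction 1 / (Wd.realPeriodRat : ℂ) = (qd : ℂ)) (hqd0 : qd ≠ 0)
    (hvd : padicValRat p qd = 0) (hI : ¬ p ∣ (AddSubgroup.zmultiples P).index)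
    (htam : ¬ p ∣ W.tamagawaProduct) :
    BSDp W p := by
  have hp : p.Prime := Fact.out
  -- `w_K = 2`, prime to the odd `p`
  have hμ : ¬ p ∣ Units.torsionOrder K := by
    rw [Literature.NumberTheory.DiophantineGeometry.torsionOrder_eq_two_of_discr_lt hK.1 hdK]
    intro h2
    exact hp2 ((Nat.prime_dvd_prime_iff_eq hp Nat.prime_two).mp h2)
  have hu : padicValRat p (Cd.u : ℚ) = 0 :=
    padicValRat_u_eq_zero_of_twist_minimal_of_dvd W p K hK hHN hpN Cd hWd
  exact bsdp_of_rankOne_of_indexCertificate W p (W.conductorNorm ℤ) K Dt H ι P hGZ hKo hB hGZK hmod hK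
    hHN hP hp2 hc hμ hr hsurj Wd Cd hWd hu qd hqd hqd0 hvd hI htam

/-! ### §2 Pair AND twist, any odd `p ∣ N_E`, Heegner field with odd `d_K < -4` -/

/-- **Rank one, ANY odd `p ∣ N_E`, `ρ̄_{E,p}` onto, Heegner field with `d_K` ODD and `d_K < −4`: the
exact index certificate closes BOTH the pair and its rank-zero Heegner twist at `p`.** Gen 5's
`bsdp_and_bsdp_twist_of_indexCertificate_of_dvd` with `p ≥ 5` replaced by `p` odd + `d_K` odd: the
twist's Tamagawa transport is eisenstein-p2's `X2.padicValNat_tamagawaProduct_twist_of_heegner_of_odd`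
(`p ∤ d_K` because `p ∣ N_E` splits in `K`). CERTIFICATE as in §1. CONCLUSION: `BSDp W p ∧ BSDp Wd p`
(the twist: Kolyvagin's bound gives `ord_p #Ш(E/K) = 0`, the Gross–Zagier bookkeeping identity
`X11b.exists_shaAn_padicVal_eq_of_heegner` gives `ord_p #Ш(E/K) = ord_p #Ш(E) + ord_p #Ш(Wd)`, so
`ord_p #Ш(Wd) = 0`; `p ∤ ∏c_ℓ(Wd)`, no rational `p`-torsion, rank-zero print shape). Per pair;
nothing booked; class-agnostic (X4 any additive type, X7, X8, X11 at `p = 3` alike).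
[cite: McCallumLMS1991, §1 Theorem (Kolyvagin), p. 296] [cite: JetchevSkinnerWan2017, §7.4 (pp. 29–31)]
[cite: SilvermanATAEC1994, IV.9.4 Table 4.1] [cite: Miller2011LMS, Def. 1.1] -/
theorem bsdp_and_bsdp_twist_of_indexCertificate_of_odd
    (W : WeierstrassCurve ℚ) [W.IsElliptic] [W.IsGloballyMinimal] (p : ℕ) [Fact p.Prime]
    [NeZero (W.conductorNorm ℤ)] (K : Type) [Field K] [NumberField K]
    (Dt : ModularParametrizationData W (W.conductorNorm ℤ))
    (H : HeegnerDatum (W.conductorNorm ℤ) (NumberField.discr K)) (ι : K →+* ℂ)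
    (P : (W.baseChange K).toAffine.Point)
    -- the published inputs (named facts of the tree)
    (hGZ : gross_zagier (W.conductorNorm ℤ) W K) (hKo : kolyvagin (W.conductorNorm ℤ) W K)
    (hB : Kolyvagin1990_padicValNat_card_sha_le (W.conductorNorm ℤ) W K)
    (hGZK : rank_eq_analyticRank_of_analyticRank_le_one) (hmod : hasEntireLFunction_rat)
    -- the pair and the Heegner data
    (hp2 : p ≠ 2) (hpN : p ∣ W.conductorNorm ℤ) (hr : W.analyticRank = 1) (hsurj : Surj W p)
    (hK : IsImaginaryQuadratic K) (hHN : SatisfiesHeegnerHypothesis (W.conductorNorm ℤ) K)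
    (hodd : Odd (NumberField.discr K)) (hdK : NumberField.discr K < -4)
    (hP : WeierstrassCurve.Affine.Point.map ι.toRatAlgHom P = heegnerPointComplex Dt H)
    (hc : ¬ (p : ℤ) ∣ Dt.c)
    (Wd : WeierstrassCurve ℚ) [Wd.IsElliptic] [Wd.IsGloballyMinimal] (Cd : VariableChange ℚ)
    (hWd : Cd • W.quadraticTwist (NumberField.discr K : ℚ) = Wd)
    -- the certificate
    (qd : ℚ) (hqd : Wd.entireLFunction 1 / (Wd.realPeriodRat : ℂ) = (qd : ℂ)) (hqd0 : qd ≠ 0)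
    (hvd : padicValRat p qd = 0) (hI : ¬ p ∣ (AddSubgroup.zmultiples P).index)
    (htam : ¬ p ∣ W.tamagawaProduct) :
    BSDp W p ∧ BSDp Wd p := by
  have hp : p.Prime := Fact.out
  have hirr : Irr W p := hasIrreducibleModPGaloisRep_of_hasSurjectiveModNGaloisRep W p hsurj
  -- `w_K = 2`, prime to the odd `p`; `ord_p u = 0`; `p ∤ d_K`
  have hμ : ¬ p ∣ Units.torsionOrder K := by
    rw [Literature.NumberTheory.DiophantineGeometry.torsionOrder_eq_two_of_discr_lt hK.1 hdK]
    intro h2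
    exact hp2 ((Nat.prime_dvd_prime_iff_eq hp Nat.prime_two).mp h2)
  have hu : padicValRat p (Cd.u : ℚ) = 0 :=
    padicValRat_u_eq_zero_of_twist_minimal_of_dvd W p K hK hHN hpN Cd hWd
  have hpd : ¬ (p : ℤ) ∣ NumberField.discr K :=
    Literature.SatisfiesHeegnerHypothesis.not_dvd_discr hK.1 hHN hp hpN
  refine ⟨bsdp_of_rankOne_of_indexCertificate W p (W.conductorNorm ℤ) K Dt H ι P hGZ hKo hB hGZK hmod
    hK hHN hP hp2 hc hμ hr hsurj Wd Cd hWd hu qd hqd hqd0 hvd hI htam, ?_⟩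
  ---------------------------------------------------------------- the twist
  have hD0 : (NumberField.discr K : ℚ) ≠ 0 := by exact_mod_cast NumberField.discr_ne_zero K
  haveI hEt : (W.quadraticTwist (NumberField.discr K : ℚ)).IsElliptic :=
    W.isElliptic_quadraticTwist hD0
  have hLt' : (W.quadraticTwist (NumberField.discr K : ℚ)).entireLFunction = Wd.entireLFunction := by
    rw [← hWd, entireLFunction_smul]
  have hLt : (W.quadraticTwist (NumberField.discr K : ℚ)).entireLFunction 1 ≠ 0 := by
    rw [hLt']
    intro h0
    apply hqd0
    have : ((qd : ℂ)) = 0 := by rw [← hqd, h0, zero_div]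
    exact_mod_cast this
  have hLd1 : Wd.entireLFunction 1 ≠ 0 := by rw [← hLt']; exact hLt
  have hrd : Wd.analyticRank = 0 := (Wd.analyticRank_eq_zero_iff_holds (hmod Wd)).2 hLd1
  have hirrd : Wd.HasIrreducibleModPGaloisRep p :=
    X11b.hasIrreducibleModPGaloisRep_twist_model W p K hK.1 hirr Cd hWd
  have htors : padicValNat p Wd.torsionOrder = 0 :=
    padicValNat_torsionOrder_eq_zero_of_irreducible Wd p hirrd
  have htamd : padicValNat p Wd.tamagawaProduct = 0 := by
    rw [X2.padicValNat_tamagawaProduct_twist_of_heegner_of_odd W p hp2 K hK hodd hpd hHN Cd hWd]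
    exact padicValNat.eq_zero_of_not_dvd htam
  -- the identity: finiteness and the `Ш` decomposition over `K`
  obtain ⟨hfinW, hfinK, hsum, -⟩ :=
    X11b.exists_shaAn_padicVal_eq_of_heegner W p (W.conductorNorm ℤ) K Dt H ι P hGZ hKo hGZK hmod hK
      hHN hP hp2 hc hμ hr hLt Wd Cd hWd hu qd hqd
  -- the Heegner point is non-torsion; Kolyvagin's bound kills `Ш(E/K)[p^∞]`
  have hPH : IsHeegnerPoint (W.conductorNorm ℤ) W K P := ⟨Dt, H, ι, hP⟩
  have hL0 : W.entireLFunction 1 = 0 := entireLFunction_one_eq_zero_of_analyticRank_eq_one hr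
  obtain ⟨-, hderiv⟩ := leadingLCoeff_eq_deriv_of_analyticRank_eq_one hr
  have hLK : LDerivEK W K ≠ 0 := by
    rw [lDerivEK_eq_deriv_mul W K hmod hL0]
    exact mul_ne_zero hderiv hLt
  have hnt : ¬ IsOfFinAddOrder P :=
    (lDerivEK_ne_zero_iff_not_isOfFinAddOrder W (W.conductorNorm ℤ) K hGZ hK hHN hPH).mp hLK
  have hbound := hB hK hHN hPH hnt hp hp2 hsurj
  haveI : Finite (W.baseChange K).sha := hfinK
  have hKsha : padicValNat p (W.baseChange K).shaOrder = 0 := by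
    have h0 : padicValNat p (AddSubgroup.zmultiples P).index = 0 := padicValNat.eq_zero_of_not_dvd hI
    have : padicValNat p (Nat.card (W.baseChange K).sha) = 0 := by
      have := hbound; rw [h0, mul_zero] at this; exact Nat.le_zero.mp this
    simpa [WeierstrassCurve.shaOrder] using this
  have hshad : padicValNat p Wd.shaOrder = 0 := by
    rw [hKsha] at hsum
    omega
  -- the rank-zero print shape for the twist
  refine bsdp_of_pPartRankZero Wd p hmod hGZK hrd ⟨qd, hqd, ?_⟩
  rw [hvd, hshad, htamd, htors]
  simp

/-! ### §3 This sub-cell: X4(M) rank-one pairs at every odd `p` (`p = 3` included) -/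

variable {W : WeierstrassCurve ℚ} [W.IsElliptic] {p : ℕ} [Fact p.Prime]

/-- **X4(M) ∧ surj(p), rank one, ANY odd `p`: `BSD(E,p)` and `BSD(E^{d_K},p)` from the exact index
certificate at a Heegner field with odd `d_K < −4`** (`p ∣ N_E` because `p` is additive; at `p = 3`
this is new — 85 of the 87 rank-one X4(M) census pairs at `p = 3` have surj(3)). Per pair; X4(M)
stays CONSTRUCTION-SHAPED; nothing booked. [cite: McCallumLMS1991, §1 Theorem (Kolyvagin), p. 296]
[cite: Miller2011LMS, Def. 1.1] -/
theorem ClassX4M.bsdp_rankOne_of_indexCertificate_of_surj [W.IsGloballyMinimal]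
    [NeZero (W.conductorNorm ℤ)]
    (hX : ClassX4M W p) (hr : W.analyticRank = 1) (hsurj : Surj W p)
    (K : Type) [Field K] [NumberField K]
    (Dt : ModularParametrizationData W (W.conductorNorm ℤ))
    (H : HeegnerDatum (W.conductorNorm ℤ) (NumberField.discr K)) (ι : K →+* ℂ)
    (P : (W.baseChange K).toAffine.Point)
    (hGZ : gross_zagier (W.conductorNorm ℤ) W K) (hKo : kolyvagin (W.conductorNorm ℤ) W K)
    (hB : Kolyvagin1990_padicValNat_card_sha_le (W.conductorNorm ℤ) W K)
    (hGZK : rank_eq_analyticRank_of_analyticRank_le_one) (hmod : hasEntireLFunction_rat)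
    (hK : IsImaginaryQuadratic K) (hHN : SatisfiesHeegnerHypothesis (W.conductorNorm ℤ) K)
    (hodd : Odd (NumberField.discr K)) (hdK : NumberField.discr K < -4)
    (hP : WeierstrassCurve.Affine.Point.map ι.toRatAlgHom P = heegnerPointComplex Dt H)
    (hc : ¬ (p : ℤ) ∣ Dt.c)
    (Wd : WeierstrassCurve ℚ) [Wd.IsElliptic] [Wd.IsGloballyMinimal] (Cd : VariableChange ℚ)
    (hWd : Cd • W.quadraticTwist (NumberField.discr K : ℚ) = Wd)
    (qd : ℚ) (hqd : Wd.entireLFunction 1 / (Wd.realPeriodRat : ℂ) = (qd : ℂ)) (hqd0 : qd ≠ 0)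
    (hvd : padicValRat p qd = 0) (hI : ¬ p ∣ (AddSubgroup.zmultiples P).index)
    (htam : ¬ p ∣ W.tamagawaProduct) :
    BSDp W p ∧ BSDp Wd p :=
  have hpN : p ∣ W.conductorNorm ℤ :=
    (W.dvd_conductorNorm_iff_not_hasGoodReductionAtPrime p).mpr (not_good_of_addv W p hX.1.2.1)
  bsdp_and_bsdp_twist_of_indexCertificate_of_odd W p K Dt H ι P hGZ hKo hB hGZK hmod hX.p_ne_two hpN
    hr hsurj hK hHN hodd hdK hP hc Wd Cd hWd qd hqd hqd0 hvd hI htam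

/-- **X4(M) ∧ `p ∤ ord_p j(E)`, rank one, ANY odd `p`: the image hypothesis DISCHARGED** (multr1-p2's
`ClassX4M.surj_of_not_dvd_padicValRat_j`: the inertia at a potentially multiplicative `p` supplies a
transvection, `Irr ⇒ Surj`; 73 of the 85 surjective rank-one X4(M) pairs at `p = 3`), so `BSD(E,p)`
and `BSD(E^{d_K},p)` follow from the finite certificate and PUBLISHED facts alone. Per pair; nothing
booked. [cite: SilvermanATAEC1994, V.6 Prop. 6.1 (p. 410) and V.5.3]
[cite: McCallumLMS1991, §1 Theorem (Kolyvagin), p. 296] [cite: Miller2011LMS, Def. 1.1] -/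
theorem ClassX4M.bsdp_rankOne_of_indexCertificate_of_not_dvd_padicValRat_j [W.IsGloballyMinimal]
    [NeZero (W.conductorNorm ℤ)]
    (hX : ClassX4M W p) (hr : W.analyticRank = 1) (hj : ¬ (p : ℤ) ∣ padicValRat p W.j)
    (K : Type) [Field K] [NumberField K]
    (Dt : ModularParametrizationData W (W.conductorNorm ℤ))
    (H : HeegnerDatum (W.conductorNorm ℤ) (NumberField.discr K)) (ι : K →+* ℂ)
    (P : (W.baseChange K).toAffine.Point)
    (hGZ : gross_zagier (W.conductorNorm ℤ) W K) (hKo : kolyvagin (W.conductorNorm ℤ) W K)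
    (hB : Kolyvagin1990_padicValNat_card_sha_le (W.conductorNorm ℤ) W K)
    (hGZK : rank_eq_analyticRank_of_analyticRank_le_one) (hmod : hasEntireLFunction_rat)
    (hK : IsImaginaryQuadratic K) (hHN : SatisfiesHeegnerHypothesis (W.conductorNorm ℤ) K)
    (hodd : Odd (NumberField.discr K)) (hdK : NumberField.discr K < -4)
    (hP : WeierstrassCurve.Affine.Point.map ι.toRatAlgHom P = heegnerPointComplex Dt H)
    (hc : ¬ (p : ℤ) ∣ Dt.c)
    (Wd : WeierstrassCurve ℚ) [Wd.IsElliptic] [Wd.IsGloballyMinimal] (Cd : VariableChange ℚ)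
    (hWd : Cd • W.quadraticTwist (NumberField.discr K : ℚ) = Wd)
    (qd : ℚ) (hqd : Wd.entireLFunction 1 / (Wd.realPeriodRat : ℂ) = (qd : ℂ)) (hqd0 : qd ≠ 0)
    (hvd : padicValRat p qd = 0) (hI : ¬ p ∣ (AddSubgroup.zmultiples P).index)
    (htam : ¬ p ∣ W.tamagawaProduct) :
    BSDp W p ∧ BSDp Wd p :=
  ClassX4M.bsdp_rankOne_of_indexCertificate_of_surj hX hr (ClassX4M.surj_of_not_dvd_padicValRat_j hX hj)
    K Dt H ι P hGZ hKo hB hGZK hmod hK hHN hodd hdK hP hc Wd Cd hWd qd hqd hqd0 hvd hI htam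

end Summit.BirchSwinnertonDyer.Rank1Residual.AdditivePotMult

end
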